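import Literature.NumberTheory.EllipticCurves.Kato2004.AdditivePotGoodRankZeroShaUpperBound
import Literature.NumberTheory.EllipticCurves.BSDSelmerPConverseRamifiedProofs
import Summits.BirchSwinnertonDyer.Rank1Residual.Additive.X4RankZeroUpperBound
import Literature.NumberTheory.EllipticCurves.Rank1Residual.Typed.CasselsLowerBound
import HarnessLib

/-!
# X4♯(3) on its potentially-good, big-image rows: `ord_3 #Ш ≤ ord_3 #Ш_an` and `BSD(E,3)` from Kato 2004 Thm. 14.5 (3) (cell `b2b-bsdres`, seat additive-p4, line V20)

HONEST FRAMING (cell `b2b-bsdres`, run/shared/lean/b2b/bsd-rank1-residual/, verbatim in every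
file): the goal of the cell is to DELETE the COMBINATION-SHAPED residual classes of the
Birch–Swinnerton-Dyer formula for ALL analytic-rank `≤ 1` elliptic curves over `ℚ` — "full BSD
formula for every rank `≤ 1` curve in class `C`" assembled STRICTLY from published theorems — so
that the rank-`≤ 1` remainder becomes exactly the CONSTRUCTION-SHAPED classes, which are TYPED
(missing-input `Prop`s), NOT attempted. This is not "finishing BSD". The additive sub-cell
(seats additive-p1…p4) is a RESEARCH ROUTE on the construction-shaped classes X3/X4; no claim
beyond the stated classes; labels unchanged; nothing is booked by this file.

**What this file proves** (theorems only; no definition, no new named fact). The sharpened conjecture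
X4♯(3) (`Additive.X4SharpThree`, SHARPENED-CONJECTURES §4 (i): Kim's rank-`0` inequality
`ord_3 #Ш ≤ ord_3 #Ш_an + ord_3 ∏ c_ℓ` on X4 ∧ `p = 3` ∧ `r_an = 0` ∧ surj(3), the 1582 ‖ 417 census
pairs where Kim 2026's `p ≥ 5` binds ALONE) is a THEOREM on the sub-block
  `(E, 3)` potentially good at `3` (`ord_3 j_E ≥ 0`: every TAME type I₀*, III, III* AND every WILD type
  II, IV, IV*, II* with `3³ ∣ N`) ∧ `ρ_{E,3^∞}` onto `GL₂(ℤ₃)` (census: surj(3) ∧ ram(3), tree theorem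
  `hasSurjectiveModNGaloisRep_pow_of_hasMultiplicativeReductionAtPrime`) ∧ `3 ∤ ∏ c_ℓ`,
from the named fact `Kato2004.rankZero_padicValNat_sha_le_of_additive_potGood_of_imageContainsSL2`
(K. Kato, Astérisque 295 (2004), Thm. 14.5 (3) with Prop. 14.16 (2), §14.1, §14.8, Thm. 12.5 (1);
local index C.-H. Kim AJM 2026 Lemma 3.10 / Kim–Nakamura 2020 Cor. 2.4 — the Euler-system
INEQUALITY, stated for every `p ≠ 2`; no Kolyvagin system, no Kurihara number, no `p`-adic
`L`-function, no twist), Gross–Zagier–Kolyvagin (`hGZK`) and modularity (`hmod`):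
* `padicValNat_shaOrder_le_of_kato_rankZero` (shape of the Kim sibling
  `padicValNat_shaOrder_le_of_kim_rankZero`, with `5 ≤ p` replaced by Kato's hypotheses):
  `#Ш_an = q` and `ord_p #Ш ≤ ord_p q + ord_p ∏ c_ℓ − 2 ord_p #E(ℚ)_tors` at every odd additive
  potentially good `p` with (12.5.2) and `p ∤ ∏ c_ℓ`;
* `X4RankZero.padicValNat_shaOrder_le_of_kato`, `X4RankZero.missingUpperBoundAt_of_kato`,
  `X4RankZero.missingPPartAt_iff_lower_of_kato`, `X4RankZero.bsdp_of_missingLowerBoundAt_of_kato`,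
  `X4RankZero.bsdp_of_shaAn_unit_of_kato` (census shape over `ClassX4`, tower surjectivity
  `∀ n, surj(p^n)`): the typed UPPER half holds, the typed X4 input reduces to the LOWER half, and
  `BSD(E,p)` holds on the `p`-unit rows — at EVERY odd additive potentially good `p` (at `p ≥ 5` this
  is the Kim sibling `X4RankZeroUpperBound.lean` with one hypothesis more; at `p = 3` it is NEW);
* `X4RankZero.bsdp_three_of_kato_of_surj_of_ram` — THE CENSUS SHAPE at `p = 3`: X4 ∧ `r_an = 0` ∧
  `ord_3 j ≥ 0` ∧ surj(3) ∧ ram(3) (a multiplicative prime `ℓ ≠ 3` with `3 ∤ v_ℓ(Δ_min)`) ∧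
  `3 ∤ ∏ c_ℓ` ∧ `#Ш_an` a `3`-unit ∧ Manin datum `⇒ BSD(E,3)`;
* `X4RankZero.bsdp_of_kato_of_casselsTate_of_pow_dvd` / `…bsdp_three_of_kato_of_surj_of_ram_of_casselsTate`
  — the `p ∣ #Ш_an` rows: Kato's upper half + Cassels–Tate squareness + ONE `p`-descent certificate;
* `x4SharpThree_holds_of_potGood_of_towerSurj` — the conjecture `X4SharpThree`'s conclusion on the
  sub-block, as a theorem.
CENSUS (engine A = hyp seat `hyp_bits.tsv` bits surj/ram/pot_mult/tam/sha_an/optimal+manin, all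
two-engine there; recount `HOME/b2b-bsdres-additive-p4/V20-CENSUS-engineA.tsv`): of the 1582 ‖ 417
X4♯(3) unit rows, **866** are potentially good with surj ∧ ram (756 of them non-exceptional at `3`,
110 exceptional — irrelevant here: `t` cancels in Kato's `ν`), every one an optimal curve with Manin
constant `1` (Cremona): `BSD(E,3)` for each from PUBLISHED theorems + census bits; 388 of them are
WILD (`v_3(N) ≥ 3`: II* 187, IV* 94, II 73, IV 34) — the first kernel route of the cell at a wild
additive `3`. NOT covered: the 670 potentially multiplicative rows (Kato 14.5 (3) needs potential
good reduction; these are the (M) rows of lines V15/V16, which need the twin's data) and 46 rows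
without a (ram) prime (a `3`-adic image certificate from elsewhere would do). Per pair; the class
label X4 is UNCHANGED (CONSTRUCTION-SHAPED); nothing is booked by this file.

WHY NOVEL (line V20 of the seat's REPAIR-CENSUS): every earlier kernel route to `BSD(E,3)` at an
additive `3` in the cell (V14/V14b/V15/V16/V18/V19b; additive-p1/p2's χ-branch components) goes
through the SEMISTABLE TWIST `V = E ⊗ χ_{−3}` and the cyclotomic main-conjecture divisibility over
`ℚ(ζ_{3^∞})` (Kato 17.4 / Wuthrich 16), hence needs `e = 2` (I₀*/I_n*) or potential multiplicativity
and the twin's data; the wild and `e ∈ {3,4,6,12}` rows had "no input in print". Kato's Thm. 14.5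
(3) is twist-free and ordinarity-free: it is the base-level Euler-system bound, printed for `p ≠ 2`
and potentially good `f` — read with Prop. 14.16 (2) it IS Kim's inequality at `p = 3`. Nearest
prior art: Kim 2026 Thm. 1.8 (6) (`p ≥ 5`), Kim–Nakamura 2020 Thm. 1.7 / Rem. 1.8 (1) (equality
from a Kurihara number; `p > 7` blanket), the cell's T-KIM0 (`X4RankZero.bsdp_of_shaAn_unit`, `p ≥ 5`).

References: Kato 2004 [Kato2004Asterisque] Thm. 14.5 (3), Prop. 14.16 (2), Thm. 12.5; Kim 2026
[Kim2022StructureSelmer] Lemma 3.10; Kim–Nakamura 2020 [KimNakamura2020] Cor. 2.4, Rem. 1.5 (3);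
Miller 2011 [Miller2011LMS] Def. 1.1; Mazur 1977 [Mazur1977] III.5; Serre 1972 / BSTW 2024 (ram)
[BurungaleSkinnerTianWan2024]; SHARPENED-CONJECTURES §4 (i).
-/

noncomputable section

open scoped Classical

open WeierstrassCurve Literature.NumberTheory.EllipticCurves
  Literature.NumberTheory.EllipticCurves.ModularForms
  Literature.NumberTheory.EllipticCurves.Rank1Residual
  Literature.NumberTheory.EllipticCurves.Rank1Residual.Typed

namespace Summit.BirchSwinnertonDyer.Rank1Residual.Additive

variable (W : WeierstrassCurve ℚ) [W.IsElliptic] [W.IsGloballyMinimal] (p : ℕ) [Fact p.Prime]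

/-! ### The rank-`0` upper bound with the torsion term, from Kato's fact -/

/-- **Upper bound on `ord_p #Ш` in analytic rank `0` at an odd ADDITIVE POTENTIALLY GOOD prime with
big `p`-adic image (Kato 2004 Thm. 14.5 (3) with Prop. 14.16 (2), named fact `hKato`;
Gross–Zagier–Kolyvagin `hGZK`; modularity `hmod`).** With `#Ш_an = L(E,1)·#E(ℚ)_tors²/(Ω·∏ c_ℓ)`
(rank `0`), Kato's `ord_p #Ш(p) ≤ ord_p(L(E,1)/Ω)` reads: `#Ш_an = q ∈ ℚ` and
`ord_p #Ш ≤ ord_p q + ord_p ∏ c_ℓ − 2 ord_p #E(ℚ)_tors`. Hypotheses: `p ≠ 2`, neither good nor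
multiplicative at `p`, `0 ≤ ord_p j`, Kato's (12.5.2) `Kato2004.ImageContainsSL2 W p`, `p ∤ ∏ c_ℓ`,
a parametrisation datum `D` with `p ∤ c_D`.
[cite: Kato2004Asterisque, Thm. 14.5 (3) (p. 236), Prop. 14.16 (2) (p. 244)] [cite: Miller2011LMS, Def. 1.1] -/
theorem padicValNat_shaOrder_le_of_kato_rankZero
    (hKato : Kato2004.rankZero_padicValNat_sha_le_of_additive_potGood_of_imageContainsSL2)
    (hGZK : rank_eq_analyticRank_of_analyticRank_le_one) (hmod : hasEntireLFunction_rat)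
    (hp : p ≠ 2) (hgood : ¬ W.HasGoodReductionAtPrime p) (hmult : ¬ W.HasMultiplicativeReductionAtPrime p)
    (hpot : 0 ≤ padicValRat p W.j) (hbig : Kato2004.ImageContainsSL2 W p)
    (htam : ¬ p ∣ W.tamagawaProduct) (hr : W.analyticRank = 0)
    {N : ℕ} [NeZero N] (D : ModularParametrizationData W N) (hc : ¬ (p : ℤ) ∣ D.maninConstant) :
    ∃ q : ℚ, shaAn W = (q : ℂ) ∧
      (padicValNat p W.shaOrder : ℤ) ≤
        padicValRat p q + padicValNat p W.tamagawaProduct - 2 * padicValNat p W.torsionOrder := by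
  have hL : W.entireLFunction 1 ≠ 0 := (W.analyticRank_eq_zero_iff_holds (hmod W)).mp hr
  obtain ⟨hmw, hfin⟩ := hGZK W (by rw [hr]; exact zero_le_one)
  haveI : Finite W.sha := hfin
  have hmw0 : W.mordellWeilRank = 0 := by rw [hmw, hr]
  obtain ⟨q₀, hq₀, hle⟩ := hKato W p hp hgood hmult hpot hbig htam hL hfin D hc
  -- positivity of the BSD denominators
  have hΩpos : 0 < W.realPeriodRat := W.realPeriodRat_pos_holds
  have hΩ : (W.realPeriodRat : ℂ) ≠ 0 := by exact_mod_cast hΩpos.ne'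
  have hc0 : 0 < W.tamagawaProduct := W.tamagawaProduct_pos_holds
  have ht0 : 0 < W.torsionOrder := W.torsionOrder_pos_holds
  have hq₀0 : q₀ ≠ 0 := by
    rintro rfl
    rw [Rat.cast_zero, div_eq_zero_iff] at hq₀
    exact hq₀.elim hL hΩ
  refine ⟨q₀ * (W.torsionOrder : ℚ) ^ 2 / (W.tamagawaProduct : ℚ), ?_, ?_⟩
  · -- `#Ш_an = (L(E,1)/Ω) · #tors² / ∏ c_ℓ`
    have hLq : W.entireLFunction 1 = (q₀ : ℂ) * (W.realPeriodRat : ℂ) := by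
      rw [← hq₀, div_mul_cancel₀ _ hΩ]
    rw [shaAn_def, leadingLCoeff_eq_of_analyticRank_eq_zero W hr,
      W.regulator_eq_one_of_rank_zero hmw0, hLq]
    push_cast
    field_simp
  · -- valuations
    have ht : (W.torsionOrder : ℚ) ≠ 0 := by exact_mod_cast ht0.ne'
    have hcq : (W.tamagawaProduct : ℚ) ≠ 0 := by exact_mod_cast hc0.ne'
    have hsha : padicValNat p (Nat.card (AddCommGroup.primaryComponent W.sha p)) =
        padicValNat p W.shaOrder := by
      unfold WeierstrassCurve.shaOrder
      exact padicValNat_card_addPrimaryComponent p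
    have hv : padicValRat p (q₀ * (W.torsionOrder : ℚ) ^ 2 / (W.tamagawaProduct : ℚ)) =
        padicValRat p q₀ + 2 * (padicValNat p W.torsionOrder : ℤ) -
          (padicValNat p W.tamagawaProduct : ℤ) := by
      rw [padicValRat.div (mul_ne_zero hq₀0 (pow_ne_zero 2 ht)) hcq,
        padicValRat.mul hq₀0 (pow_ne_zero 2 ht), pow_two, padicValRat.mul ht ht,
        padicValRat.of_nat, padicValRat.of_nat]
      ring
    rw [hv, ← hsha]
    linarith

/-! ### Class X4, analytic rank `0`, odd additive potentially good `p`, `ρ_{E,p^∞}` onto -/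

/-- **X4 ∧ `r = 0` at an odd potentially good additive `p` with `ρ̄_{E,p^n}` onto for every `n`,
`p ∤ ∏ c_ℓ` and a datum `D` with `p ∤ c_D`: `ord_p #Ш(E) ≤ ord_p #Ш_an(E) + ord_p ∏ c_ℓ`** — the
"≤" half of X4♯ on these pairs, from PUBLISHED theorems (Kato 2004 Thm. 14.5 (3) + Prop. 14.16 (2)
`hKato`, Gross–Zagier–Kolyvagin `hGZK`, modularity `hmod`); tower surjectivity is Kato's (12.5.2)
(`Kato2004.imageContainsSL2_of_forall_hasSurjectiveModNGaloisRep`); the torsion term vanishes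
because `E[p]` is irreducible (`hX.2.2`, Mazur 1977). Valid at `p = 3`.
[cite: Kato2004Asterisque, Thm. 14.5 (3) (p. 236), (12.5.2) (p. 222)] [cite: Mazur1977, Ch. III §5, p. 157] -/
theorem X4RankZero.padicValNat_shaOrder_le_of_kato
    (hKato : Kato2004.rankZero_padicValNat_sha_le_of_additive_potGood_of_imageContainsSL2)
    (hGZK : rank_eq_analyticRank_of_analyticRank_le_one) (hmod : hasEntireLFunction_rat)
    (hr : W.analyticRank = 0) (hX : ClassX4 W p) (hpot : 0 ≤ padicValRat p W.j)
    (hsurj : ∀ n : ℕ, W.HasSurjectiveModNGaloisRep (p ^ n : ℕ)) (htam : ¬ p ∣ W.tamagawaProduct)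
    {N : ℕ} [NeZero N] (D : ModularParametrizationData W N) (hc : ¬ (p : ℤ) ∣ D.maninConstant) :
    ∃ q : ℚ, shaAn W = (q : ℂ) ∧
      (padicValNat p W.shaOrder : ℤ) ≤ padicValRat p q + padicValNat p W.tamagawaProduct := by
  obtain ⟨hp2, ⟨hgood, hmult⟩, hirr⟩ := hX
  obtain ⟨q, hq, hle⟩ :=
    padicValNat_shaOrder_le_of_kato_rankZero W p hKato hGZK hmod hp2 hgood hmult hpot
      (Kato2004.imageContainsSL2_of_forall_hasSurjectiveModNGaloisRep W p hsurj) htam hr D hc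
  refine ⟨q, hq, ?_⟩
  rw [padicValNat_torsionOrder_eq_zero_of_irreducible W p hirr] at hle
  simpa using hle

/-- **The typed UPPER half `MissingUpperBoundAt W p` (`ord_p #Ш ≤ ord_p #Ш_an`) holds on X4 ∧ `r = 0`
at an odd potentially good additive `p` with tower surjectivity, `p ∤ ∏ c_ℓ` and `p ∤ c_D`** — in
particular at `p = 3`. [cite: Kato2004Asterisque, Thm. 14.5 (3) (p. 236)] [cite: Miller2011LMS, Def. 1.1] -/
theorem X4RankZero.missingUpperBoundAt_of_kato
    (hKato : Kato2004.rankZero_padicValNat_sha_le_of_additive_potGood_of_imageContainsSL2)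
    (hGZK : rank_eq_analyticRank_of_analyticRank_le_one) (hmod : hasEntireLFunction_rat)
    (hr : W.analyticRank = 0) (hX : ClassX4 W p) (hpot : 0 ≤ padicValRat p W.j)
    (hsurj : ∀ n : ℕ, W.HasSurjectiveModNGaloisRep (p ^ n : ℕ)) (htam : ¬ p ∣ W.tamagawaProduct)
    {N : ℕ} [NeZero N] (D : ModularParametrizationData W N) (hc : ¬ (p : ℤ) ∣ D.maninConstant) :
    MissingUpperBoundAt W p := by
  obtain ⟨q, hq, hle⟩ :=
    X4RankZero.padicValNat_shaOrder_le_of_kato W p hKato hGZK hmod hr hX hpot hsurj htam D hc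
  refine ⟨q, hq, ?_⟩
  rw [padicValNat.eq_zero_of_not_dvd htam, Nat.cast_zero, add_zero] at hle
  exact hle

/-- **On these pairs the typed missing input of X4 is EQUIVALENT to its LOWER half**
(`MissingPPartAt W p ↔ MissingLowerBoundAt W p`): the main-conjecture direction is all that is left.
[cite: Kato2004Asterisque, Thm. 14.5 (3) (p. 236)] [cite: Miller2011LMS, Def. 1.1] -/
theorem X4RankZero.missingPPartAt_iff_lower_of_kato
    (hKato : Kato2004.rankZero_padicValNat_sha_le_of_additive_potGood_of_imageContainsSL2)
    (hGZK : rank_eq_analyticRank_of_analyticRank_le_one) (hmod : hasEntireLFunction_rat)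
    (hr : W.analyticRank = 0) (hX : ClassX4 W p) (hpot : 0 ≤ padicValRat p W.j)
    (hsurj : ∀ n : ℕ, W.HasSurjectiveModNGaloisRep (p ^ n : ℕ)) (htam : ¬ p ∣ W.tamagawaProduct)
    {N : ℕ} [NeZero N] (D : ModularParametrizationData W N) (hc : ¬ (p : ℤ) ∣ D.maninConstant) :
    MissingPPartAt W p ↔ MissingLowerBoundAt W p :=
  ⟨fun h => (lower_and_upper_of_missingPPartAt W p h).1, fun h =>
    missingPPartAt_of_lower_of_upper W p h
      (X4RankZero.missingUpperBoundAt_of_kato W p hKato hGZK hmod hr hX hpot hsurj htam D hc)⟩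

/-- **`BSD(E,p)` on these pairs from the LOWER half alone.** [cite: Miller2011LMS, §1 and Def. 1.1] -/
theorem X4RankZero.bsdp_of_missingLowerBoundAt_of_kato
    (hKato : Kato2004.rankZero_padicValNat_sha_le_of_additive_potGood_of_imageContainsSL2)
    (hGZK : rank_eq_analyticRank_of_analyticRank_le_one) (hmod : hasEntireLFunction_rat)
    (hr : W.analyticRank = 0) (hX : ClassX4 W p) (hpot : 0 ≤ padicValRat p W.j)
    (hsurj : ∀ n : ℕ, W.HasSurjectiveModNGaloisRep (p ^ n : ℕ)) (htam : ¬ p ∣ W.tamagawaProduct)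
    {N : ℕ} [NeZero N] (D : ModularParametrizationData W N) (hc : ¬ (p : ℤ) ∣ D.maninConstant)
    (hlow : MissingLowerBoundAt W p) : BSDp W p :=
  X4.bsdp_of_missingInputAt hGZK W p (by rw [hr]; exact zero_le_one) hX
    ((X4RankZero.missingPPartAt_iff_lower_of_kato W p hKato hGZK hmod hr hX hpot hsurj htam D hc).mpr
      hlow)

/-- **`BSD(E,p)` WITHOUT a certificate on X4 ∧ `r = 0` at an odd potentially good additive `p` with
`ρ̄_{E,p^n}` onto for all `n`, `p ∤ c_D` and `p ∤ ∏ c_ℓ · #Ш_an`**: the inequality forces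
`ord_p #Ш = 0 = ord_p #Ш_an`, i.e. Miller's `BSD(E,p)`. PUBLISHED theorems (Kato 2004 Thm. 14.5 (3) +
Prop. 14.16 (2), Gross–Zagier–Kolyvagin, modularity) + per pair ONLY [`r_an = 0`, `#Ш_an` a `p`-unit,
`p ∤ ∏ c_ℓ`, `p ∤ c_D`, `ord_p j ≥ 0`, tower surjectivity]. At `p = 3` this is new (see
`bsdp_three_of_kato_of_surj_of_ram` for the census shape); per pair; class label unchanged.
[cite: Kato2004Asterisque, Thm. 14.5 (3) (p. 236)] [cite: Miller2011LMS, §1 and Def. 1.1] -/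
theorem X4RankZero.bsdp_of_shaAn_unit_of_kato
    (hKato : Kato2004.rankZero_padicValNat_sha_le_of_additive_potGood_of_imageContainsSL2)
    (hGZK : rank_eq_analyticRank_of_analyticRank_le_one) (hmod : hasEntireLFunction_rat)
    (hr : W.analyticRank = 0) (hX : ClassX4 W p) (hpot : 0 ≤ padicValRat p W.j)
    (hsurj : ∀ n : ℕ, W.HasSurjectiveModNGaloisRep (p ^ n : ℕ)) (htam : ¬ p ∣ W.tamagawaProduct)
    {N : ℕ} [NeZero N] (D : ModularParametrizationData W N) (hc : ¬ (p : ℤ) ∣ D.maninConstant)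
    {q : ℚ} (hq : shaAn W = (q : ℂ)) (hv : padicValRat p q = 0) : BSDp W p :=
  bsdp_of_shaOrder_le_of_shaAn_unit W p hGZK (by rw [hr]; exact zero_le_one)
    (X4RankZero.padicValNat_shaOrder_le_of_kato W p hKato hGZK hmod hr hX hpot hsurj htam D hc)
    htam hq hv

/-- The same, concluding the typed missing input of class X4 (`Typed.X4.MissingInputAt W p`).
[cite: Miller2011LMS, Def. 1.1] -/
theorem X4RankZero.missingInputAt_of_shaAn_unit_of_kato
    (hKato : Kato2004.rankZero_padicValNat_sha_le_of_additive_potGood_of_imageContainsSL2)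
    (hGZK : rank_eq_analyticRank_of_analyticRank_le_one) (hmod : hasEntireLFunction_rat)
    (hr : W.analyticRank = 0) (hX : ClassX4 W p) (hpot : 0 ≤ padicValRat p W.j)
    (hsurj : ∀ n : ℕ, W.HasSurjectiveModNGaloisRep (p ^ n : ℕ)) (htam : ¬ p ∣ W.tamagawaProduct)
    {N : ℕ} [NeZero N] (D : ModularParametrizationData W N) (hc : ¬ (p : ℤ) ∣ D.maninConstant)
    {q : ℚ} (hq : shaAn W = (q : ℂ)) (hv : padicValRat p q = 0) : X4.MissingInputAt W p := by
  haveI : Finite W.sha := (hGZK W (by rw [hr]; exact zero_le_one)).2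
  exact missingPPartAt_of_bsdp W p
    (X4RankZero.bsdp_of_shaAn_unit_of_kato W p hKato hGZK hmod hr hX hpot hsurj htam D hc hq hv)

/-! ### The census shape at `p = 3`: surj(3) ∧ ram(3) -/

/-- **V20 — `BSD(E,3)` on X4 ∧ `r_an = 0` ∧ potentially good ∧ surj(3) ∧ ram(3) ∧ units.** For an X4
pair `(E, 3)` of analytic rank `0` with `ord_3 j_E ≥ 0` (every tame type I₀*/III/III* and every WILD
type II/IV/IV*/II*), `ρ̄_{E,3}` surjective and a multiplicative prime `ℓ ≠ 3` with `3 ∤ v_ℓ(Δ_min)`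
(census bits surj(3), ram(3): then `ρ̄_{E,3^n}` is onto for every `n` by the tree theorem
`hasSurjectiveModNGaloisRep_pow_of_hasMultiplicativeReductionAtPrime`, i.e. Kato's (12.5.2)),
`3 ∤ ∏ c_ℓ`, `#Ш_an` a `3`-unit and a parametrisation datum `D` with `3 ∤ c_D` (optimal curve,
`c = 1`, Cremona), Miller's `BSD(E,3)` holds — from PUBLISHED theorems (Kato 2004 Thm. 14.5 (3) +
Prop. 14.16 (2) `hKato`; Gross–Zagier–Kolyvagin `hGZK`; modularity `hmod`) and census bits only: NO
Kurihara number, no twist, no `p`-adic `L`-function. Census: 866 of the 1582 ‖ 417 X4♯(3) rows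
(388 of them wild). Per pair; class label X4 unchanged; nothing booked.
[cite: Kato2004Asterisque, Thm. 14.5 (3) (p. 236), (12.5.2) (p. 222)]
[cite: BurungaleSkinnerTianWan2024, Part II (sur), (ram) (p. 74)] [cite: Miller2011LMS, §1 and Def. 1.1] -/
theorem X4RankZero.bsdp_three_of_kato_of_surj_of_ram
    (hKato : Kato2004.rankZero_padicValNat_sha_le_of_additive_potGood_of_imageContainsSL2)
    (hGZK : rank_eq_analyticRank_of_analyticRank_le_one) (hmod : hasEntireLFunction_rat)
    (hr : W.analyticRank = 0) (hX : ClassX4 W 3) (hpot : 0 ≤ padicValRat 3 W.j) (hsurj : Surj W 3)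
    (hram : Ram W 3)
    (htam : ¬ 3 ∣ W.tamagawaProduct)
    {N : ℕ} [NeZero N] (D : ModularParametrizationData W N) (hc : ¬ (3 : ℤ) ∣ D.maninConstant)
    {q : ℚ} (hq : shaAn W = (q : ℂ)) (hv : padicValRat 3 q = 0) : BSDp W 3 :=
  X4RankZero.bsdp_of_shaAn_unit_of_kato W 3 hKato hGZK hmod hr hX hpot
    (hasSurjectiveModNGaloisRep_pow_of_hasMultiplicativeReductionAtPrime W 3 hsurj hram) htam D
    (by exact_mod_cast hc) hq hv

/-- **The typed upper half at `p = 3` in the census shape** (surj(3) ∧ ram(3), `3 ∤ ∏ c_ℓ`, `3 ∤ c_D`,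
`ord_3 j ≥ 0`): `MissingUpperBoundAt W 3` — also on the rows with `3 ∣ #Ш_an`, where the LOWER half
(one `3`-descent certificate `Ш(E)[3] ≠ 0`, Cassels–Tate squeeze) is what remains.
[cite: Kato2004Asterisque, Thm. 14.5 (3) (p. 236)] [cite: Miller2011LMS, Def. 1.1] -/
theorem X4RankZero.missingUpperBoundAt_three_of_kato_of_surj_of_ram
    (hKato : Kato2004.rankZero_padicValNat_sha_le_of_additive_potGood_of_imageContainsSL2)
    (hGZK : rank_eq_analyticRank_of_analyticRank_le_one) (hmod : hasEntireLFunction_rat)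
    (hr : W.analyticRank = 0) (hX : ClassX4 W 3) (hpot : 0 ≤ padicValRat 3 W.j) (hsurj : Surj W 3)
    (hram : Ram W 3)
    (htam : ¬ 3 ∣ W.tamagawaProduct)
    {N : ℕ} [NeZero N] (D : ModularParametrizationData W N) (hc : ¬ (3 : ℤ) ∣ D.maninConstant) :
    MissingUpperBoundAt W 3 :=
  X4RankZero.missingUpperBoundAt_of_kato W 3 hKato hGZK hmod hr hX hpot
    (hasSurjectiveModNGaloisRep_pow_of_hasMultiplicativeReductionAtPrime W 3 hsurj hram) htam D
    (by exact_mod_cast hc)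

/-! ### The `p ∣ #Ш_an` rows: Cassels–Tate squeeze from ONE descent certificate -/

/-- **`BSD(E,p)` on the `p ∣ #Ш_an` rows from ONE finite certificate** (X4 ∧ `r_an = 0` at an odd
potentially good additive `p`, tower surjectivity, `p ∤ ∏ c_ℓ`, `p ∤ c_D`): if `#Ш_an(E) = q` with
`ord_p q ≤ 2k` and `p^{2k−1} ∣ #Ш(E)` (for `k = 1`: `Ш(E)[p] ≠ 0`, one `p`-descent certificate), then
`BSD(E,p)` — the upper half is Kato's (`X4RankZero.missingUpperBoundAt_of_kato`), the lower half is
Cassels–Tate squareness (`hCT`, `Typed.missingLowerBoundAt_of_casselsTate_of_pow_dvd`).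
[cite: Kato2004Asterisque, Thm. 14.5 (3) (p. 236)] [cite: SilvermanAEC2009, Thm. X.4.14]
[cite: Miller2011LMS, §1 and Def. 1.1] -/
theorem X4RankZero.bsdp_of_kato_of_casselsTate_of_pow_dvd
    (hKato : Kato2004.rankZero_padicValNat_sha_le_of_additive_potGood_of_imageContainsSL2)
    (hGZK : rank_eq_analyticRank_of_analyticRank_le_one) (hmod : hasEntireLFunction_rat)
    (hCT : exists_casselsTate_pairing (K := ℚ))
    (hr : W.analyticRank = 0) (hX : ClassX4 W p) (hpot : 0 ≤ padicValRat p W.j)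
    (hsurj : ∀ n : ℕ, W.HasSurjectiveModNGaloisRep (p ^ n : ℕ)) (htam : ¬ p ∣ W.tamagawaProduct)
    {N : ℕ} [NeZero N] (D : ModularParametrizationData W N) (hc : ¬ (p : ℤ) ∣ D.maninConstant)
    {q : ℚ} (hq : shaAn W = (q : ℂ)) {k : ℕ} (hv : padicValRat p q ≤ 2 * k)
    (hdvd : p ^ (2 * k - 1) ∣ W.shaOrder) : BSDp W p :=
  bsdp_of_missingPPartAt W p hGZK (by rw [hr]; exact zero_le_one)
    (missingPPartAt_of_lower_of_upper W p
      (missingLowerBoundAt_of_casselsTate_of_pow_dvd W p hCT (hGZK W (by rw [hr]; exact zero_le_one)).2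
        hq hv hdvd)
      (X4RankZero.missingUpperBoundAt_of_kato W p hKato hGZK hmod hr hX hpot hsurj htam D hc))

/-- **Census shape at `p = 3` for the 15 rows with `#Ш_an = 9`** (REQUESTS R14 (a): 3555e1, 7353c1,
9999e1, 12987a1, 13248bm1, 14976k1, 15930b1, 16074b1, 16830p1, 17928c1, 18288e1, 18324a1, 19215t1,
19575h1, 19575j1): surj(3) ∧ ram(3) ∧ `ord_3 j ≥ 0` ∧ `3 ∤ ∏ c_ℓ` ∧ `3 ∤ c_D` ∧ `ord_3 #Ш_an ≤ 2` ∧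
ONE 3-descent certificate `3 ∣ #Ш(E)` `⇒ BSD(E,3)`. [cite: Kato2004Asterisque, Thm. 14.5 (3) (p. 236)]
[cite: SilvermanAEC2009, Thm. X.4.14] [cite: Miller2011LMS, §1 and Def. 1.1] -/
theorem X4RankZero.bsdp_three_of_kato_of_surj_of_ram_of_casselsTate
    (hKato : Kato2004.rankZero_padicValNat_sha_le_of_additive_potGood_of_imageContainsSL2)
    (hGZK : rank_eq_analyticRank_of_analyticRank_le_one) (hmod : hasEntireLFunction_rat)
    (hCT : exists_casselsTate_pairing (K := ℚ))
    (hr : W.analyticRank = 0) (hX : ClassX4 W 3) (hpot : 0 ≤ padicValRat 3 W.j) (hsurj : Surj W 3)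
    (hram : Ram W 3)
    (htam : ¬ 3 ∣ W.tamagawaProduct)
    {N : ℕ} [NeZero N] (D : ModularParametrizationData W N) (hc : ¬ (3 : ℤ) ∣ D.maninConstant)
    {q : ℚ} (hq : shaAn W = (q : ℂ)) (hv : padicValRat 3 q ≤ 2) (hdvd : 3 ∣ W.shaOrder) : BSDp W 3 :=
  X4RankZero.bsdp_of_kato_of_casselsTate_of_pow_dvd W 3 hKato hGZK hmod hCT hr hX hpot
    (hasSurjectiveModNGaloisRep_pow_of_hasMultiplicativeReductionAtPrime W 3 hsurj hram) htam D
    (by exact_mod_cast hc) hq (k := 1) (by simpa using hv) (by simpa using hdvd)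

/-! ### The conjecture X4♯(3) on the potentially-good big-image sub-block is a theorem -/

/-- **X4♯(3) restricted to `ord_3 j ≥ 0` ∧ tower surjectivity ∧ `3 ∤ ∏ c_ℓ` HOLDS** (granted the
Kato fact, Gross–Zagier–Kolyvagin and modularity): the conclusion of `Additive.X4SharpThree`
(`∃ q, #Ш_an = q ∧ ord_3 #Ш ≤ ord_3 q + ord_3 ∏ c_ℓ`) for every X4 pair `(E, 3)` of analytic rank `0`
with `ρ̄_{E,3^n}` onto for all `n` and a datum `D` with `3 ∤ c_D`. What remains CONJECTURAL of X4♯(3)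
after this file: the potentially multiplicative rows, the rows with `3 ∣ ∏ c_ℓ`, and the rows where
`ρ̄_{E,3}` is onto but no tower-surjectivity certificate is available.
[cite: Kato2004Asterisque, Thm. 14.5 (3) (p. 236)] -/
theorem x4SharpThree_holds_of_potGood_of_towerSurj
    (hKato : Kato2004.rankZero_padicValNat_sha_le_of_additive_potGood_of_imageContainsSL2)
    (hGZK : rank_eq_analyticRank_of_analyticRank_le_one) (hmod : hasEntireLFunction_rat)
    (hr : W.analyticRank = 0) (hX : ClassX4 W 3) (hpot : 0 ≤ padicValRat 3 W.j)
    (hsurj : ∀ n : ℕ, W.HasSurjectiveModNGaloisRep (3 ^ n : ℕ)) (htam : ¬ 3 ∣ W.tamagawaProduct)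
    {N : ℕ} [NeZero N] (D : ModularParametrizationData W N) (hc : ¬ (3 : ℤ) ∣ D.maninConstant) :
    ∃ q : ℚ, shaAn W = (q : ℂ) ∧
      (padicValNat 3 W.shaOrder : ℤ) ≤ padicValRat 3 q + padicValNat 3 W.tamagawaProduct :=
  X4RankZero.padicValNat_shaOrder_le_of_kato W 3 hKato hGZK hmod hr hX hpot hsurj htam D
    (by exact_mod_cast hc)


/-! ### V20b: the census shape at `p = 3` with a mod-9 certificate, surj(9), in place of surj(3) ∧ ram(3) -/
/-- **V20b — `BSD(E,3)` on X4 ∧ `r_an = 0` ∧ potentially good ∧ surj(9) ∧ units**: as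
`bsdp_three_of_kato_of_surj_of_ram`, with (12.5.2) fed by a mod-`9` certificate (`ρ̄_{E,9}` onto ⟹
`ρ̄_{E,3^n}` onto ∀ `n`, `WeierstrassCurve.forall_hasSurjectiveModNGaloisRep_three_pow_of_nine`) — for
the rows WITHOUT a (ram) prime (46 in the window, 2 939 in the sweep).
[cite: Kato2004Asterisque, Thm. 14.5 (3) (p. 236), (12.5.2) (p. 222)] [cite: Miller2011LMS, §1 and Def. 1.1] -/
theorem X4RankZero.bsdp_three_of_kato_of_surj9
    (hKato : Kato2004.rankZero_padicValNat_sha_le_of_additive_potGood_of_imageContainsSL2)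
    (hGZK : rank_eq_analyticRank_of_analyticRank_le_one) (hmod : hasEntireLFunction_rat)
    (hr : W.analyticRank = 0) (hX : ClassX4 W 3) (hpot : 0 ≤ padicValRat 3 W.j)
    (h9 : W.HasSurjectiveModNGaloisRep 9) (htam : ¬ 3 ∣ W.tamagawaProduct)
    {N : ℕ} [NeZero N] (D : ModularParametrizationData W N) (hc : ¬ (3 : ℤ) ∣ D.maninConstant)
    {q : ℚ} (hq : shaAn W = (q : ℂ)) (hv : padicValRat 3 q = 0) : BSDp W 3 :=
  X4RankZero.bsdp_of_shaAn_unit_of_kato W 3 hKato hGZK hmod hr hX hpot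
    (WeierstrassCurve.forall_hasSurjectiveModNGaloisRep_three_pow_of_nine W h9) htam D
    (by exact_mod_cast hc) hq hv

/-- **The typed upper half at `p = 3` with a mod-9 certificate**: X4 ∧ `r_an = 0` ∧ `ord_3 j ≥ 0` ∧
surj(9) ∧ `3 ∤ ∏ c_ℓ` ∧ `3 ∤ c_D` ⟹ `MissingUpperBoundAt W 3`.
[cite: Kato2004Asterisque, Thm. 14.5 (3) (p. 236)] [cite: Miller2011LMS, Def. 1.1] -/
theorem X4RankZero.missingUpperBoundAt_three_of_kato_of_surj9
    (hKato : Kato2004.rankZero_padicValNat_sha_le_of_additive_potGood_of_imageContainsSL2)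
    (hGZK : rank_eq_analyticRank_of_analyticRank_le_one) (hmod : hasEntireLFunction_rat)
    (hr : W.analyticRank = 0) (hX : ClassX4 W 3) (hpot : 0 ≤ padicValRat 3 W.j)
    (h9 : W.HasSurjectiveModNGaloisRep 9) (htam : ¬ 3 ∣ W.tamagawaProduct)
    {N : ℕ} [NeZero N] (D : ModularParametrizationData W N) (hc : ¬ (3 : ℤ) ∣ D.maninConstant) :
    MissingUpperBoundAt W 3 :=
  X4RankZero.missingUpperBoundAt_of_kato W 3 hKato hGZK hmod hr hX hpot
    (WeierstrassCurve.forall_hasSurjectiveModNGaloisRep_three_pow_of_nine W h9) htam D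
    (by exact_mod_cast hc)

/-- **Cassels–Tate squeeze with a mod-9 certificate** (`3 ∣ #Ш_an` rows): surj(9) ∧ `ord_3 j ≥ 0` ∧
`3 ∤ ∏ c_ℓ·c_D` ∧ `ord_3 #Ш_an ≤ 2k` ∧ `3^{2k−1} ∣ #Ш(E)` ⟹ `BSD(E,3)`. [cite: Kato2004Asterisque, Thm. 14.5 (3) (p. 236)]
[cite: SilvermanAEC2009, Thm. X.4.14] [cite: Miller2011LMS, §1 and Def. 1.1] -/
theorem X4RankZero.bsdp_three_of_kato_of_surj9_of_casselsTate
    (hKato : Kato2004.rankZero_padicValNat_sha_le_of_additive_potGood_of_imageContainsSL2)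
    (hGZK : rank_eq_analyticRank_of_analyticRank_le_one) (hmod : hasEntireLFunction_rat)
    (hCT : exists_casselsTate_pairing (K := ℚ))
    (hr : W.analyticRank = 0) (hX : ClassX4 W 3) (hpot : 0 ≤ padicValRat 3 W.j)
    (h9 : W.HasSurjectiveModNGaloisRep 9) (htam : ¬ 3 ∣ W.tamagawaProduct)
    {N : ℕ} [NeZero N] (D : ModularParametrizationData W N) (hc : ¬ (3 : ℤ) ∣ D.maninConstant)
    {q : ℚ} (hq : shaAn W = (q : ℂ)) {k : ℕ} (hv : padicValRat 3 q ≤ 2 * k)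
    (hdvd : 3 ^ (2 * k - 1) ∣ W.shaOrder) : BSDp W 3 :=
  X4RankZero.bsdp_of_kato_of_casselsTate_of_pow_dvd W 3 hKato hGZK hmod hCT hr hX hpot
    (WeierstrassCurve.forall_hasSurjectiveModNGaloisRep_three_pow_of_nine W h9) htam D
    (by exact_mod_cast hc) hq hv hdvd

end Summit.BirchSwinnertonDyer.Rank1Residual.Additive

end
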